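import Summits.QuantumFields.YangMills.Theorems.F4SubCurvatureDoorCauchyKernel
import Mathlib
import HarnessLib

/-!
# The planar Laplace–Fourier transform of a finite measure is the Fourier transform of a FINITE planar measure

Helper (definition-free) for the by-name rung `TwoMirrorLFConstancy` / `HexagonalLFConstancy` of LINE g19-A «transverse
slice» on crux ⟨stmt-QuantumFields-23035⟩ (rung file `Cruxes/ShortRootRigidity/Lines/transverse_slice_rung_bounded.lean`).

For a finite measure `μ` on `(E, p) ∈ ℝ × ℝ` carried by `E ≥ 0`, the planar Laplace–Fourier transform
`k(t, x) = ∫ e^{-E|t|} cos(p x) dμ` is `½ · charFunDual ν` of the finite planar measure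
`ν = law of (E·ξ, p) + law of (E·ξ, -p)` under `μ ⊗ C(dξ)` (`C` the standard Cauchy law; `e^{-E|t|} = ∫e^{itEξ}dC`):
`exists_planarFourierMeasure`.  Consequently (Mathlib's `Measure.ext_of_charFunDual`) an invariance
`k(ct - sx, st + cx) = k(t, x)` of `k` under a linear map is inherited by `ν`, and `ν` of any measurable planar set is
computed from `μ` by the FRAME FORMULA `ν(A) = ∫ [C{ξ : (Eξ, p) ∈ A} + C{ξ : (Eξ, -p) ∈ A}] dμ(E, p)`.

HONEST LABEL: measure-theoretic bookkeeping; nothing about ⟨23035⟩, R2d or any summit is proved by this file.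
-/

noncomputable section

open MeasureTheory Set Filter Topology
open scoped ENNReal NNReal

namespace Summit.QuantumFields.YangMills.Theorems.F4SubCurvatureDoorPlanarLFFourierMeasure

open Summit.QuantumFields.YangMills.Theorems.F4SubCurvatureDoorCauchyKernel BoundedContinuousFunction

/-- A continuous linear functional on `ℝ × ℝ` in coordinates: `L(u, v) = u·L(1,0) + v·L(0,1)`. -/
theorem dual_apply_eq (L : StrongDual ℝ (ℝ × ℝ)) (u v : ℝ) :
    L (u, v) = u * L (1, 0) + v * L (0, 1) := by
  have e : ((u, v) : ℝ × ℝ) = u • ((1 : ℝ), (0 : ℝ)) + v • ((0 : ℝ), (1 : ℝ)) := by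
    ext <;> simp
  rw [e, map_add, map_smul, map_smul, smul_eq_mul, smul_eq_mul]

/-- The fibre integral: `∫ e^{i L(Eξ, q)} dC(ξ) = e^{-|L(1,0)·E|} e^{i q L(0,1)}`. -/
theorem integral_cexp_dual_fibre (L : StrongDual ℝ (ℝ × ℝ)) (E q : ℝ) :
    ∫ x : ℝ, Complex.exp (((L (E * x, q) : ℝ) : ℂ) * Complex.I)
        ∂(volume.withDensity fun x : ℝ => ENNReal.ofReal (Real.pi⁻¹ * (1 + x ^ 2)⁻¹))
      = ((Real.exp (-|L (1, 0) * E|) : ℝ) : ℂ) * Complex.exp (((q * L (0, 1) : ℝ) : ℂ) * Complex.I) := by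
  have e : ∀ x : ℝ, Complex.exp (((L (E * x, q) : ℝ) : ℂ) * Complex.I)
      = Complex.exp (((L (1, 0) * (E * x) : ℝ) : ℂ) * Complex.I) * Complex.exp (((q * L (0, 1) : ℝ) : ℂ) * Complex.I) := by
    intro x
    rw [← Complex.exp_add, dual_apply_eq]
    push_cast
    ring_nf
  simp_rw [e]
  rw [integral_mul_const, integral_cexp_mul_cauchy]

/-- **Existence of the finite planar Fourier measure.**  For a finite measure `μ` on `ℝ × ℝ` with `μ{E < 0} = 0` whose
planar Laplace–Fourier transform `k(t,x) = ∫ e^{-E|t|}cos(px)dμ` satisfies `k(ct - sx, st + cx) = k(t, x)`, there is a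
finite measure `ν` on `ℝ × ℝ` with the frame formula `ν(A) = ∫[C{ξ:(Eξ,p)∈A} + C{ξ:(Eξ,-p)∈A}]dμ` which is invariant in
the sense `ν{q : (cq₀ + sq₁, -sq₀ + cq₁) ∈ B} = ν(B)`. -/
theorem exists_planarFourierMeasure (μ : Measure (ℝ × ℝ)) [IsFiniteMeasure μ]
    (hsupp : μ {z | z.1 < 0} = 0) {c s : ℝ}
    (hk : ∀ t x : ℝ,
      ∫ z, Real.exp (-(z.1 * |c * t - s * x|)) * Real.cos (z.2 * (s * t + c * x)) ∂μ
        = ∫ z, Real.exp (-(z.1 * |t|)) * Real.cos (z.2 * x) ∂μ) :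
    ∃ ν : Measure (ℝ × ℝ), IsFiniteMeasure ν ∧
      (∀ A : Set (ℝ × ℝ), MeasurableSet A →
        ν A = (∫⁻ z, (volume.withDensity fun x : ℝ => ENNReal.ofReal (Real.pi⁻¹ * (1 + x ^ 2)⁻¹))
                  {x : ℝ | (z.1 * x, z.2) ∈ A} ∂μ)
            + ∫⁻ z, (volume.withDensity fun x : ℝ => ENNReal.ofReal (Real.pi⁻¹ * (1 + x ^ 2)⁻¹))
                  {x : ℝ | (z.1 * x, -z.2) ∈ A} ∂μ) ∧
      (∀ B : Set (ℝ × ℝ), MeasurableSet B →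
        ν {q | (c * q.1 + s * q.2, -s * q.1 + c * q.2) ∈ B} = ν B) := by
  -- the Cauchy law and the two parametrisations
  set C : Measure ℝ := volume.withDensity fun x : ℝ => ENNReal.ofReal (Real.pi⁻¹ * (1 + x ^ 2)⁻¹) with hC
  haveI : IsProbabilityMeasure C := isProbabilityMeasure_cauchy
  set F : (ℝ × ℝ) × ℝ → ℝ × ℝ := fun w => (w.1.1 * w.2, w.1.2) with hF
  set G : (ℝ × ℝ) × ℝ → ℝ × ℝ := fun w => (w.1.1 * w.2, -w.1.2) with hG
  have hFc : Continuous F := by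
    simp only [hF]
    fun_prop
  have hGc : Continuous G := by
    simp only [hG]
    fun_prop
  have hFm : Measurable F := hFc.measurable
  have hGm : Measurable G := hGc.measurable
  set P : Measure ((ℝ × ℝ) × ℝ) := μ.prod C with hP
  haveI : IsFiniteMeasure P := by rw [hP]; infer_instance
  set ν : Measure (ℝ × ℝ) := P.map F + P.map G with hν
  haveI hνfin : IsFiniteMeasure ν := by rw [hν]; infer_instance
  -- a.e. nonnegativity of the energy
  have hae : ∀ᵐ z ∂μ, 0 ≤ z.1 := by
    rw [ae_iff]
    simpa [not_le] using hsupp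
  -- the transform `k`
  set k : ℝ → ℝ → ℝ := fun t x => ∫ z, Real.exp (-(z.1 * |t|)) * Real.cos (z.2 * x) ∂μ with hk_def
  -- characteristic function of ν
  have hchar : ∀ L : StrongDual ℝ (ℝ × ℝ), charFunDual ν L = 2 * ((k (L (1, 0)) (L (0, 1)) : ℝ) : ℂ) := by
    intro L
    set a := L (1, 0) with ha
    set b := L (0, 1) with hb
    have hint : ∀ (m : Measure (ℝ × ℝ)) [IsFiniteMeasure m], Integrable (fun v => probCharDual L v) m :=
      fun m _ => (probCharDual L).integrable m
    rw [charFunDual, hν, integral_add_measure (hint _) (hint _),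
      integral_map hFm.aemeasurable (probCharDual L).continuous.aestronglyMeasurable,
      integral_map hGm.aemeasurable (probCharDual L).continuous.aestronglyMeasurable]
    have hIF : Integrable (fun w => probCharDual L (F w)) P :=
      (integrable_map_measure (probCharDual L).continuous.aestronglyMeasurable hFm.aemeasurable).1 (hint _)
    have hIG : Integrable (fun w => probCharDual L (G w)) P :=
      (integrable_map_measure (probCharDual L).continuous.aestronglyMeasurable hGm.aemeasurable).1 (hint _)
    rw [hP, integral_prod _ hIF, integral_prod _ hIG, ← integral_add]
    rotate_left
    · exact hIF.integral_prod_left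
    · exact hIG.integral_prod_left
    -- fibre integrals
    have eF : ∀ z : ℝ × ℝ, ∫ x, probCharDual L (F (z, x)) ∂C
        = ((Real.exp (-|a * z.1|) : ℝ) : ℂ) * Complex.exp (((z.2 * b : ℝ) : ℂ) * Complex.I) := by
      intro z
      simp only [hF, probCharDual_apply]
      exact integral_cexp_dual_fibre L z.1 z.2
    have eG : ∀ z : ℝ × ℝ, ∫ x, probCharDual L (G (z, x)) ∂C
        = ((Real.exp (-|a * z.1|) : ℝ) : ℂ) * Complex.exp (((-z.2 * b : ℝ) : ℂ) * Complex.I) := by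
      intro z
      simp only [hG, probCharDual_apply]
      exact integral_cexp_dual_fibre L z.1 (-z.2)
    simp_rw [eF, eG]
    -- combine: e^{-|aE|}(e^{ipb} + e^{-ipb}) = 2 e^{-E|a|} cos(pb) for E ≥ 0
    have hpt : ∀ᵐ z ∂μ, ((Real.exp (-|a * z.1|) : ℝ) : ℂ) * Complex.exp (((z.2 * b : ℝ) : ℂ) * Complex.I)
          + ((Real.exp (-|a * z.1|) : ℝ) : ℂ) * Complex.exp (((-z.2 * b : ℝ) : ℂ) * Complex.I)
        = (2 : ℂ) * (((Real.exp (-(z.1 * |a|)) * Real.cos (z.2 * b) : ℝ) : ℂ)) := by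
      filter_upwards [hae] with z hz
      have h1 : |a * z.1| = z.1 * |a| := by rw [abs_mul, abs_of_nonneg hz, mul_comm]
      rw [h1, ← mul_add]
      have h2 : Complex.exp (((z.2 * b : ℝ) : ℂ) * Complex.I) + Complex.exp (((-z.2 * b : ℝ) : ℂ) * Complex.I)
          = 2 * ((Real.cos (z.2 * b) : ℝ) : ℂ) := by
        rw [Complex.ofReal_cos, Complex.cos]
        push_cast
        ring_nf
      rw [h2]
      push_cast
      ring
    rw [integral_congr_ae hpt, integral_const_mul, integral_complex_ofReal]
  refine ⟨ν, hνfin, ?_, ?_⟩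
  · -- frame formula
    intro A hA
    rw [hν, Measure.add_apply, Measure.map_apply hFm hA, Measure.map_apply hGm hA, hP,
      Measure.prod_apply (hFm hA), Measure.prod_apply (hGm hA)]
    rfl
  · -- invariance, via the characteristic function
    intro B hB
    set R : (ℝ × ℝ) →L[ℝ] (ℝ × ℝ) :=
      (c • ContinuousLinearMap.fst ℝ ℝ ℝ + s • ContinuousLinearMap.snd ℝ ℝ ℝ).prod
        ((-s) • ContinuousLinearMap.fst ℝ ℝ ℝ + c • ContinuousLinearMap.snd ℝ ℝ ℝ) with hR
    have hRapply : ∀ q : ℝ × ℝ, R q = (c * q.1 + s * q.2, -s * q.1 + c * q.2) := by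
      intro q
      simp [hR]
    have hmap : ν.map R = ν := by
      apply Measure.ext_of_charFunDual
      funext L
      rw [charFunDual_map, hchar, hchar]
      have h1 : (L.comp R) (1, 0) = c * L (1, 0) - s * L (0, 1) := by
        rw [ContinuousLinearMap.comp_apply, hRapply, dual_apply_eq]
        ring
      have h2 : (L.comp R) (0, 1) = s * L (1, 0) + c * L (0, 1) := by
        rw [ContinuousLinearMap.comp_apply, hRapply, dual_apply_eq]
        ring
      rw [h1, h2]
      simp only [hk_def]
      rw [hk]
    have e : {q : ℝ × ℝ | (c * q.1 + s * q.2, -s * q.1 + c * q.2) ∈ B} = R ⁻¹' B := by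
      ext q
      simp only [mem_setOf_eq, mem_preimage, hRapply]
    rw [e, ← Measure.map_apply R.continuous.measurable hB, hmap]

end Summit.QuantumFields.YangMills.Theorems.F4SubCurvatureDoorPlanarLFFourierMeasure

end
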